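import Mathlib
import Literature.NumberTheory.Transcendental.KZProduct
import Literature.NumberTheory.Transcendental.KZCalculusProofs
import Literature.NumberTheory.Transcendental.KZVolumeConjectureProofs
import Literature.NumberTheory.Transcendental.SemialgebraicMapsProofs
import Summits.KontsevichZagierPeriods.KontsevichZagierPeriods.Theorems.SoloInformedPolyJacobian
import HarnessLib
import HarnessLib.Audit

/-!
# SoloInformed — dilations along the last axis, in every dimension

The dimension-`3` dilation lemma of `SoloInformedDilation` in every dimension `m + 1`: for a volume
representation `[σ, 1]`, `σ ⊂ ℝᵐ⁺¹` compact, and `c ≥ 1`, the dilate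
`Φ_c(x₀, …, x_{m−1}, x_m) = (x₀, …, x_{m−1}, c·x_m)` satisfies `[Φ_c σ, 1] − c · [σ, 1] ∈ relations`
(`soloInformed_lastStretchRep_sub_nsmul_mem_relations`): rule (2) for the polynomial
diffeomorphism `Φ_c` (`|det Φ_c'| = c`) gives `[σ, c] ∼ [Φ_c σ, 1]`, and integrand additivity gives
`[σ, c] ∼ c · [σ, 1]`. The dilate is a compact solid with non-empty interior of volume `c · vol σ`.
This is how positive integer multiples of volumes are realised by honest solids when a volume rung
is applied in dimension `m + 1` (`SoloInformedWallFaces`).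

Residency `solo-KontsevichZagierPeriods-informed` (PLAN.md, session s18).
References: M. Kontsevich, D. Zagier, *Periods* (2001), §1.2 (rules (1)–(2)).
-/

noncomputable section

open MeasureTheory Set Filter
open scoped Topology

namespace Summit.KontsevichZagierPeriods.KontsevichZagierPeriods.Theorems

open Literature.NumberTheory.Transcendental Literature.NumberTheory.Transcendental.KZ
open Literature.ModelTheory.ExponentialFields (IsSemialgebraic isSemialgebraic_setOf_eval_le
  isSemialgebraic_setOf_eval_lt)

variable {m : ℕ}

/-! ### The dilation `Φ_c` along the last coordinate of `ℝᵐ⁺¹` -/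

/-- `Φ_c(x) = (x₀, …, x_{m−1}, c·x_m)` as polynomials. -/
def soloInformedLastScalePoly (m c : ℕ) : Fin (m + 1) → MvPolynomial (Fin (m + 1)) ℚ :=
  fun j => if j = Fin.last m then MvPolynomial.C (c : ℚ) * MvPolynomial.X j else MvPolynomial.X j

/-- The dilation `Φ_c` along the last coordinate. -/
def soloInformedLastScale (m c : ℕ) : (Fin (m + 1) → ℝ) → (Fin (m + 1) → ℝ) :=
  soloInformedPolyMap (soloInformedLastScalePoly m c)

/-- `Φ_c` multiplies the last coordinate by `c` and fixes the others. -/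
theorem soloInformedLastScale_eq_update (c : ℕ) (u : Fin (m + 1) → ℝ) :
    soloInformedLastScale m c u = Function.update u (Fin.last m) ((c : ℝ) * u (Fin.last m)) := by
  ext j
  by_cases hj : j = Fin.last m
  · subst hj
    simp [soloInformedLastScale, soloInformedLastScalePoly]
  · simp [soloInformedLastScale, soloInformedLastScalePoly, hj]

/-- `Φ_c` is continuous. -/
theorem soloInformed_continuous_lastScale (c : ℕ) : Continuous (soloInformedLastScale m c) :=
  continuous_iff_continuousAt.2 fun u =>
    (soloInformed_hasFDerivAt_polyMap (soloInformedLastScalePoly m c) u).continuousAt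

/-- The symbolic Jacobian of `Φ_c` is the diagonal matrix `diag(1, …, 1, c)`. -/
theorem soloInformed_jacMat_lastScalePoly (c : ℕ) :
    soloInformedJacMat (soloInformedLastScalePoly m c) =
      Matrix.diagonal fun j => if j = Fin.last m then MvPolynomial.C (c : ℚ) else 1 := by
  ext j i
  rw [soloInformedJacMat_apply, Matrix.diagonal_apply]
  by_cases hj : j = Fin.last m
  · subst hj
    by_cases hi : Fin.last m = i
    · subst hi
      simp [soloInformedLastScalePoly, MvPolynomial.pderiv_X]
    · simp [soloInformedLastScalePoly, MvPolynomial.pderiv_X, hi]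
  · by_cases hi : j = i
    · subst hi
      simp [soloInformedLastScalePoly, MvPolynomial.pderiv_X, hj]
    · simp [soloInformedLastScalePoly, MvPolynomial.pderiv_X, hj, hi]

/-- `det Φ_c' = c`. -/
theorem soloInformed_det_lastScale (c : ℕ) (u : Fin (m + 1) → ℝ) :
    (soloInformedJacCLM (soloInformedLastScalePoly m c) u).det = c := by
  rw [soloInformed_det_jacCLM, soloInformed_jacMat_lastScalePoly, Matrix.det_diagonal,
    Finset.prod_ite_eq']
  simp

/-- The inverse dilation `Ψ_c(x) = (x₀, …, x_{m−1}, x_m / c)`. -/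
def soloInformedLastUnscale (m c : ℕ) (x : Fin (m + 1) → ℝ) : Fin (m + 1) → ℝ :=
  Function.update x (Fin.last m) ((c : ℝ)⁻¹ * x (Fin.last m))

/-- `Ψ_c ∘ Φ_c = id` (`c ≠ 0`). -/
theorem soloInformed_lastUnscale_lastScale (c : ℕ) (hc : c ≠ 0) (u : Fin (m + 1) → ℝ) :
    soloInformedLastUnscale m c (soloInformedLastScale m c u) = u := by
  have hc' : (c : ℝ) ≠ 0 := Nat.cast_ne_zero.2 hc
  rw [soloInformedLastScale_eq_update, soloInformedLastUnscale]
  ext j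
  by_cases hj : j = Fin.last m
  · subst hj
    simp [hc']
  · simp [hj]

/-- `Φ_c ∘ Ψ_c = id` (`c ≠ 0`). -/
theorem soloInformed_lastScale_lastUnscale (c : ℕ) (hc : c ≠ 0) (x : Fin (m + 1) → ℝ) :
    soloInformedLastScale m c (soloInformedLastUnscale m c x) = x := by
  have hc' : (c : ℝ) ≠ 0 := Nat.cast_ne_zero.2 hc
  rw [soloInformedLastScale_eq_update, soloInformedLastUnscale]
  ext j
  by_cases hj : j = Fin.last m
  · subst hj
    simp [hc']
  · simp [hj]

/-- `Ψ_c` is continuous. -/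
theorem soloInformed_continuous_lastUnscale (c : ℕ) : Continuous (soloInformedLastUnscale m c) :=
  continuous_pi fun j => by
    by_cases hj : j = Fin.last m
    · subst hj
      have h : Continuous fun a : Fin (m + 1) → ℝ => (c : ℝ)⁻¹ * a (Fin.last m) :=
        continuous_const.mul (continuous_apply (Fin.last m))
      simpa [soloInformedLastUnscale] using h
    · simpa [soloInformedLastUnscale, hj] using continuous_apply j

/-- For `c ≠ 0`, the image of a set under `Φ_c` is its preimage under `Ψ_c`. -/
theorem soloInformedLastScale_image (c : ℕ) (hc : c ≠ 0) (A : Set (Fin (m + 1) → ℝ)) :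
    soloInformedLastScale m c '' A = soloInformedLastUnscale m c ⁻¹' A := by
  rw [Set.image_eq_preimage_of_inverse (soloInformed_lastUnscale_lastScale c hc)
    (soloInformed_lastScale_lastUnscale c hc)]

/-- `Φ_c` is injective (`c ≠ 0`). -/
theorem soloInformed_lastScale_injective (c : ℕ) (hc : c ≠ 0) :
    Function.Injective (soloInformedLastScale m c) :=
  (Function.LeftInverse.injective (g := soloInformedLastUnscale m c)
    (soloInformed_lastUnscale_lastScale c hc))

/-! ### The weighted and the dilated representation -/

/-- `[σ, c]`: the domain of a volume representation weighted by the constant `c`. -/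
def soloInformedLastWeightRep (r : IntegralRep (m + 1)) (hr : IsCompact r.domain) (c : ℕ) :
    IntegralRep (m + 1) where
  domain := r.domain
  integrand _ := (c : ℝ)
  isSemialgebraic_domain := r.isSemialgebraic_domain
  isSemialgebraicFunOn_integrand := isSemialgebraicFunOn_natCast r.isSemialgebraic_domain c
  integrableOn := continuous_const.continuousOn.integrableOn_compact hr

/-- `Φ_c σ` is `ℚ`-semialgebraic (Tarski–Seidenberg). -/
theorem isSemialgebraic_soloInformedLastScale_image (r : IntegralRep (m + 1)) (c : ℕ) :
    IsSemialgebraic ℚ (soloInformedLastScale m c '' r.domain) :=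
  IsSemialgebraicMapOn.isSemialgebraic_image_holds
    (isSemialgebraicMapOn_aeval r.isSemialgebraic_domain (soloInformedLastScalePoly m c)) Subset.rfl
    r.isSemialgebraic_domain

/-- `[Φ_c σ, 1]`: the dilated solid. -/
def soloInformedLastStretchRep (r : IntegralRep (m + 1)) (hr : IsCompact r.domain) (c : ℕ) :
    IntegralRep (m + 1) where
  domain := soloInformedLastScale m c '' r.domain
  integrand _ := 1
  isSemialgebraic_domain := isSemialgebraic_soloInformedLastScale_image r c
  isSemialgebraicFunOn_integrand := by
    simpa using isSemialgebraicFunOn_ratCast (isSemialgebraic_soloInformedLastScale_image r c) 1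
  integrableOn := continuous_const.continuousOn.integrableOn_compact
    (hr.image (soloInformed_continuous_lastScale c))

/-- The dilated solid is compact. -/
theorem isCompact_soloInformedLastStretchRep_domain (r : IntegralRep (m + 1))
    (hr : IsCompact r.domain) (c : ℕ) : IsCompact (soloInformedLastStretchRep r hr c).domain :=
  hr.image (soloInformed_continuous_lastScale c)

/-- The dilated solid is a volume representation (integrand `1`). -/
theorem soloInformedLastStretchRep_integrand (r : IntegralRep (m + 1)) (hr : IsCompact r.domain)
    (c : ℕ) : ∀ x ∈ (soloInformedLastStretchRep r hr c).domain,
      (soloInformedLastStretchRep r hr c).integrand x = 1 := fun _ _ => rfl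

/-- The dilated solid has non-empty interior if the solid has (`c ≠ 0`). -/
theorem soloInformed_interior_lastStretchRep_nonempty (r : IntegralRep (m + 1))
    (hr : IsCompact r.domain) (c : ℕ) (hc : c ≠ 0) (hri : (interior r.domain).Nonempty) :
    (interior (soloInformedLastStretchRep r hr c).domain).Nonempty := by
  obtain ⟨x, hx⟩ := hri
  have hopen : IsOpen (soloInformedLastScale m c '' interior r.domain) := by
    rw [soloInformedLastScale_image c hc]
    exact isOpen_interior.preimage (soloInformed_continuous_lastUnscale c)
  refine ⟨soloInformedLastScale m c x, interior_mono (image_mono interior_subset) ?_⟩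
  rw [hopen.interior_eq]
  exact mem_image_of_mem _ hx

/-- Rule (2) for `Φ_c`: `[σ, c] − [Φ_c σ, 1] ∈ relations` (`c ≠ 0`). -/
theorem soloInformed_lastWeightRep_sub_lastStretchRep_mem_relations (r : IntegralRep (m + 1))
    (hr : IsCompact r.domain) (c : ℕ) (hc : c ≠ 0) :
    of (soloInformedLastWeightRep r hr c) - of (soloInformedLastStretchRep r hr c) ∈ relations := by
  refine changeOfVariablesRel_subset_relations ⟨m + 1, soloInformedLastWeightRep r hr c,
    soloInformedLastStretchRep r hr c, soloInformedLastScale m c,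
    soloInformedJacCLM (soloInformedLastScalePoly m c),
    isSemialgebraicMapOn_aeval r.isSemialgebraic_domain (soloInformedLastScalePoly m c),
    fun u _ => (soloInformed_hasFDerivAt_polyMap (soloInformedLastScalePoly m c) u).hasFDerivWithinAt,
    (soloInformed_lastScale_injective c hc).injOn, rfl, fun u _ => ?_, rfl⟩
  show (c : ℝ) = 1 * |(soloInformedJacCLM (soloInformedLastScalePoly m c) u).det|
  rw [soloInformed_det_lastScale, abs_of_nonneg (Nat.cast_nonneg c), one_mul]

/-- Integrand additivity: `[σ, c] − c · [σ, 1] ∈ relations` for a volume representation. -/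
theorem soloInformed_lastWeightRep_sub_nsmul_mem_relations (r : IntegralRep (m + 1))
    (hr : IsCompact r.domain) (hr1 : ∀ x ∈ r.domain, r.integrand x = 1) :
    ∀ c : ℕ, of (soloInformedLastWeightRep r hr c) - c • of r ∈ relations
  | 0 => by
      have h := integrandAddRel_subset_relations ⟨m + 1, soloInformedLastWeightRep r hr 0,
        soloInformedLastWeightRep r hr 0, soloInformedLastWeightRep r hr 0, rfl, rfl,
        fun z _ => by simp [soloInformedLastWeightRep], rfl⟩
      have h' : -of (soloInformedLastWeightRep r hr 0) ∈ relations := by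
        have e : of (soloInformedLastWeightRep r hr 0) - of (soloInformedLastWeightRep r hr 0) -
            of (soloInformedLastWeightRep r hr 0) = -of (soloInformedLastWeightRep r hr 0) := by abel
        rw [← e]; exact h
      simpa using relations.neg_mem h'
  | c + 1 => by
      have step := integrandAddRel_subset_relations ⟨m + 1, soloInformedLastWeightRep r hr (c + 1),
        soloInformedLastWeightRep r hr c, r, rfl, rfl, fun z hz => by
          show ((c + 1 : ℕ) : ℝ) = (c : ℝ) + r.integrand z
          rw [hr1 z hz]; push_cast; ring, rfl⟩
      have ih := soloInformed_lastWeightRep_sub_nsmul_mem_relations r hr hr1 c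
      have e : of (soloInformedLastWeightRep r hr (c + 1)) - (c + 1) • of r =
          (of (soloInformedLastWeightRep r hr (c + 1)) - of (soloInformedLastWeightRep r hr c) - of r) +
          (of (soloInformedLastWeightRep r hr c) - c • of r) := by
        rw [add_nsmul, one_nsmul]; abel
      rw [e]
      exact relations.add_mem step ih

/-- **Dilation.** `[Φ_c σ, 1] − c · [σ, 1] ∈ relations` for a volume representation `[σ, 1]` of
dimension `m + 1` (`c ≠ 0`). [Kontsevich–Zagier 2001, §1.2 (rules (1)–(2))] -/
theorem soloInformed_lastStretchRep_sub_nsmul_mem_relations (r : IntegralRep (m + 1))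
    (hr : IsCompact r.domain) (hr1 : ∀ x ∈ r.domain, r.integrand x = 1) (c : ℕ) (hc : c ≠ 0) :
    of (soloInformedLastStretchRep r hr c) - c • of r ∈ relations := by
  have h1 := soloInformed_lastWeightRep_sub_lastStretchRep_mem_relations r hr c hc
  have h2 := soloInformed_lastWeightRep_sub_nsmul_mem_relations r hr hr1 c
  have e : of (soloInformedLastStretchRep r hr c) - c • of r =
      (of (soloInformedLastWeightRep r hr c) - c • of r) -
      (of (soloInformedLastWeightRep r hr c) - of (soloInformedLastStretchRep r hr c)) := by abel
  rw [e]
  exact relations.sub_mem h2 h1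

/-- `vol(Φ_c σ) = c · vol(σ)`. -/
theorem soloInformed_value_lastStretchRep (r : IntegralRep (m + 1)) (hr : IsCompact r.domain)
    (hr1 : ∀ x ∈ r.domain, r.integrand x = 1) (c : ℕ) (hc : c ≠ 0) :
    (soloInformedLastStretchRep r hr c).value = c * r.value := by
  have h := eval_eq_zero_of_mem_relations
    (soloInformed_lastStretchRep_sub_nsmul_mem_relations r hr hr1 c hc)
  simp only [map_sub, map_nsmul, eval_of, nsmul_eq_mul] at h
  linarith

end Summit.KontsevichZagierPeriods.KontsevichZagierPeriods.Theorems
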